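import Literature.Barriers.PneNP.RelativizationSparseScope
import Literature.Computability.Complexity.PRelAdaptiveForm
import Literature.Computability.Complexity.CoinTruncation
import Literature.Computability.Complexity.CircuitEval
import Literature.Computability.Complexity.KannanLanguage
import Literature.Computability.Complexity.NegCNFTranscoder
import HarnessLib

/-!
# Barrier catalogue `PneNP`: relativization over thin oracles — discharge of the converse
`RelativizationSparseNarrow` (`NP ⊆ P/poly ⟹` a TALLY oracle collapses `NP` to `P`)

Discharges (D-0014) the one named fact of `Literature/Barriers/PneNP/RelativizationSparseScope.lean`
(barrier audit of `RelativizationSparse`, 2026-08-16),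

> `RelativizationSparseNarrow : NP ⊆ PPoly → ∃ T, IsTally T ∧ P^T = NP^T`,

as `Literature.Barriers.PneNP.RelativizationSparseNarrow_holds`, and records the hypothesis-free
forms of its consequences (the EXACT reach of the thin-oracle loophole:
`CRelativizes {tally | sparse | P/poly} (∃ L ∈ NP^O, L ∉ P^O) ↔ NP ⊄ P/poly`; Schöning's negative
relativization `↔ (P ≠ NP → NP ⊄ P/poly)`; tally-independence `↔ (P = NP ∨ NP ⊄ P/poly)`).

## The printed argument and its formalisation

Balcázar–Book (STACS 86), §3–§4: a set with self-producible circuits — equivalently (Ko, their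
Thm. 2) one `≡ᵀₚ`-equivalent to a TALLY set — lies in `EL₁`, `NP(A) ⊆ P(SAT ⊕ A)` (their Thm. 3;
"It is clear that every set that is self-p-printable is in EL1", §5); and `P/poly` is the Cook
closure of the sparse, indeed of the tally, sets (§3: "clause (i) simply says that A is in P/poly,
that is, ... there is a sparse set S such that A ∈ P(S)"). Hartmanis–Hemachandra (STACS 86), proof
of Thm. 3.3: "U is in NP so by assumption U is in P. Thus there is a machine in P^S that on input z
computes [the advice] and then answers the P question". Here, in the tree's transcript model:

1. **`P^A` is closed under bounded adaptive reductions with a `P^A` evaluator**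
   (`AdQuery.adLang_mem_PRel_of_mem_PRel`; Ladner–Lynch–Selman 1975, §2, transitivity of `≤ᵖ_T` in
   the adaptive normal form of the tree): write the evaluator `D ∈ P^A` as `adLang Q₁ q₁ D₁ A`
   (`AdQuery.exists_eq_adLang_of_mem_PRel`) and run the two query phases as one generator
   (`AdQuery.seqQ`: ask `Q` while fewer than `m(|x|)` answers are in, then `Q₁` on the repackaged
   transcript `⟨⟨x, first m answers⟩, later answers⟩`, `AdQuery.splitFn`), with the `P` evaluator
   `splitFn ⁻¹' D₁`.
2. **`P/poly ⊆ ⋃_{T tally} P^T`** (`exists_tally_mem_PRel_of_mem_PPoly`): normalise the advice to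
   exact length `K(n) = 3p(n) + 2` (`exists_exact_advice_of_mem_PPoly`: pad inside a pair), put bit
   `j` of `a(n)` at the tally string `0^{n·K(n) + j}` (`TallyAdvice.tallyOf`; the blocks are disjoint
   since `K` is monotone, `TallyAdvice.block_inj`), and read it back with the `FP` generator
   `⟨x, bits⟩ ↦ 0^{|x|·K(|x|) + |bits|}` (`TallyAdvice.genFn`, `TallyAdvice.adBits_genFn`), so that
   the advice language itself is the evaluator (`TallyAdvice.adLang_genFn_eq`, `AdQuery.adLang_mem_PRel`).
3. **Tally sets are `EL₁`-low in the form needed** (`LongSelman.NPRel_subset_PRel_of_isTally_of_NP_subset`):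
   for tally `T` with `NP ⊆ P^T`, `NP^T ⊆ P^T` — Long–Selman's table-reading proof of the tree
   (`RelativizationSparseTallyProofs.lean`: `L = adLang (0^{|answers|}) m L₁ T` with `L₁ ∈ NP`)
   verbatim, closed with item 1 instead of `P = NP` (the evaluator `L₁` is now in `P^T`, not in `P`).
4. **Assembly** (`exists_tally_NP_subset_PRel_of_NP_subset_PPoly`, `RelativizationSparseNarrow_holds`):
   `NP ⊆ P/poly` puts `SAT ∈ P/poly`, hence `SAT ∈ P^T` for a tally `T` (item 2), hence `NP ⊆ P^T`
   (Cook–Levin, `isNPComplete_SAT_holds`; Karp ⇒ Cook, `PolyTimeKarpReducible.turing_holds`;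
   `P^{P^T} = P^T`, `mem_PRel_of_polyTimeTuringReducible_holds`), hence `NP^T ⊆ P^T` (item 3) and
   `P^T = NP^T` (`PRel_subset_NPRel_holds`).

## References

* J. L. Balcázar, R. V. Book, *On generalized Kolmogorov complexity*, STACS 86, LNCS 210 (1986)
  334–340, §3 (self-producible circuits, clause (i)), Thm. 2, §4 Thm. 3, §5 [BalcazarBook1986].
* J. Hartmanis, L. Hemachandra, *On sparse oracles separating feasible complexity classes*,
  STACS 86, LNCS 210 (1986) 321–333, Thm. 3.3 and its proof [HartmanisHemachandra1986].
* T. J. Long, A. L. Selman, *Relativizing complexity classes with sparse oracles*, J. ACM 33 (1986)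
  618–627 [LongSelman1986] (the table-reading argument, through `RelativizationSparseTallyProofs.lean`).
* R. E. Ladner, N. A. Lynch, A. L. Selman, *A comparison of polynomial time reducibilities*,
  Theoret. Comput. Sci. 1 (1975) 103–123, §2 [LadnerLynchSelman1975].
* S. Arora, B. Barak, *Computational Complexity: A Modern Approach*, CUP 2009, Def. 6.5, Thm. 6.18
  (`P/poly` = polynomial advice), Thm. 2.10 (Cook–Levin) [AroraBarakCC2009].
-/

namespace Literature.Computability.Complexity

namespace AdQuery

open _root_.Computability Polynomial OracleCompose

section SeqDefs

variable (Q : List Bool → List Bool) (m : Polynomial ℕ) (Q₁ : List Bool → List Bool)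

/-- Phase-2 repackaging `⟨x, bits⟩ ↦ ⟨⟨x, bits ↾ m|x|⟩, bits ⇂ m|x|⟩`: the first `m(|x|)` answer
bits become part of the input of the second reduction, the rest are its own answers. [folklore] -/
noncomputable def splitFn : List Bool → List Bool :=
  pairFn (truncSndFn m) (sndP ∘ dropSndFn m)

/-- **The sequential query generator**: for the first `m(|x|)` rounds ask `Q`, afterwards ask `Q₁`
on the repackaged transcript. [Ladner–Lynch–Selman 1975, §2] [folklore] -/
noncomputable def seqQ : List Bool → List Bool :=
  condFn (LenLt m) Q (Q₁ ∘ splitFn m)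

end SeqDefs

variable {Q Q₁ : List Bool → List Bool} {m : Polynomial ℕ} {A : Language Bool}

/-- Value of `splitFn` on a pair. [folklore] -/
@[simp] theorem splitFn_boolPair (m : Polynomial ℕ) (x bits : List Bool) :
    splitFn m (boolPair x bits) =
      boolPair (boolPair x (bits.take (m.eval x.length))) (bits.drop (m.eval x.length)) := by
  simp [splitFn, truncSndFn_boolPair, dropSndFn_boolPair]

/-- `splitFn m ∈ FP`. [folklore] -/
theorem splitFn_mem_FP (m : Polynomial ℕ) : splitFn m ∈ FP :=
  pairFn_mem_FP (truncSndFn_mem_FP m) (comp_mem_FP sndP_mem_FP (dropSndFn_mem_FP m))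

/-- In the first phase `seqQ` is `Q`. [folklore] -/
theorem seqQ_of_lt {x bits : List Bool} (h : bits.length < m.eval x.length) :
    seqQ Q m Q₁ (boolPair x bits) = Q (boolPair x bits) :=
  condFn_of_mem _ _ ((boolPair_mem_LenLt m x bits).2 h)

/-- In the second phase `seqQ` is `Q₁` on the repackaged transcript. [folklore] -/
theorem seqQ_of_le {x bits : List Bool} (h : m.eval x.length ≤ bits.length) :
    seqQ Q m Q₁ (boolPair x bits) =
      Q₁ (boolPair (boolPair x (bits.take (m.eval x.length))) (bits.drop (m.eval x.length))) := by
  rw [seqQ, condFn_of_not_mem _ _ (fun h' => Nat.lt_irrefl _ (((boolPair_mem_LenLt m x bits).1 h').trans_le h)),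
    Function.comp_apply, splitFn_boolPair]

/-- `seqQ Q m Q₁ ∈ FP` for `Q, Q₁ ∈ FP`. [folklore] -/
theorem seqQ_mem_FP (hQ : Q ∈ FP) (hQ₁ : Q₁ ∈ FP) : seqQ Q m Q₁ ∈ FP :=
  condFn_mem_FP (LenLt_mem_P m) hQ (comp_mem_FP hQ₁ (splitFn_mem_FP m))

/-- During the first phase the answer bits of `seqQ` are those of `Q`. [folklore] -/
theorem adBits_seqQ_of_le (x : List Bool) :
    ∀ i ≤ m.eval x.length, adBits (seqQ Q m Q₁) A x i = adBits Q A x i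
  | 0, _ => rfl
  | i + 1, hi => by
    rw [adBits_succ, adBits_succ, adBits_seqQ_of_le x i (Nat.le_of_succ_le hi),
      seqQ_of_lt (by rw [length_adBits]; exact hi)]

/-- After the first phase the answer bits of `seqQ` are those of `Q` (first `m(|x|)`) followed by
those of `Q₁` on the input `⟨x, first-phase answers⟩`. [folklore] -/
theorem adBits_seqQ_add (x : List Bool) : ∀ j : ℕ,
    adBits (seqQ Q m Q₁) A x (m.eval x.length + j) =
      adBits Q A x (m.eval x.length) ++
        adBits Q₁ A (boolPair x (adBits Q A x (m.eval x.length))) j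
  | 0 => by rw [Nat.add_zero, adBits_seqQ_of_le x _ le_rfl, adBits_zero, List.append_nil]
  | j + 1 => by
    have hpre : (adBits Q A x (m.eval x.length)).length = m.eval x.length := length_adBits _ _ _
    rw [Nat.add_succ, adBits_succ, adBits_seqQ_add x j, adBits_succ (Q := Q₁), List.append_assoc,
      seqQ_of_le (by rw [List.length_append, hpre]; exact Nat.le_add_right _ _),
      List.take_left' hpre, List.drop_left' hpre]

/-- **`P^A` is closed under bounded adaptive reductions**: `adLang Q m D A ∈ P^A` for `Q ∈ FP` and an
EVALUATOR `D ∈ P^A` (not merely `D ∈ P`, `adLang_mem_PRel`) — write `D` in adaptive normal form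
(`exists_eq_adLang_of_mem_PRel`) and run the two reductions in sequence as one (`seqQ`).
[Ladner–Lynch–Selman 1975, §2 (`≤ᵖ_T` is transitive)] [cite: LadnerLynchSelman1975, §2] -/
theorem adLang_mem_PRel_of_mem_PRel {D : Language Bool} (hQ : Q ∈ FP)
    (hD : D ∈ PRel (Oracle.ofLanguage A)) : adLang Q m D A ∈ PRel (Oracle.ofLanguage A) := by
  obtain ⟨Q₁, hQ₁, D₁, hD₁, q₁, rfl⟩ := exists_eq_adLang_of_mem_PRel hD
  set m' : Polynomial ℕ := m + q₁.comp (2 * X + 2 + m) with hm'def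
  have hm' : ∀ n, m'.eval n = m.eval n + q₁.eval (2 * n + 2 + m.eval n) := by
    intro n
    simp only [hm'def, eval_add, eval_comp, eval_mul, eval_ofNat, eval_X]
  have key : adLang Q m (adLang Q₁ q₁ D₁ A) A = adLang (seqQ Q m Q₁) m' (splitFn m ⁻¹' D₁) A := by
    ext x
    have hpre : (adBits Q A x (m.eval x.length)).length = m.eval x.length := length_adBits _ _ _
    rw [mem_adLang_iff, mem_adLang_iff, mem_adLang_iff]
    change _ ↔ splitFn m (boolPair x (adBits (seqQ Q m Q₁) A x (m'.eval x.length))) ∈ D₁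
    rw [hm', adBits_seqQ_add, splitFn_boolPair, List.take_left' hpre, List.drop_left' hpre,
      length_boolPair, hpre]
  rw [key]
  exact adLang_mem_PRel (seqQ_mem_FP hQ hQ₁) (preimage_mem_P hD₁ (splitFn_mem_FP m)) A

end AdQuery


end Literature.Computability.Complexity

namespace Literature.Barriers.PneNP

open _root_.Computability Literature.Computability.Complexity Literature.Computability.Complexity.Nondeterministic
  Literature.Computability.Complexity.Classes Polynomial OracleCompose AdQuery

/-! ### `P/poly ⊆ ⋃_{T tally} P^T` -/

/-- **Advice of exact polynomial length.** A language with polynomial advice has advice strings of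
length EXACTLY `K(n) = 3p(n) + 2`: pad `a(n)` inside a pair, `a'(n) = ⟨a(n), 0^{3p(n) − 2|a(n)|}⟩`,
and let the advice language read the first component. [cite: AroraBarakCC2009, Def. 6.5 and Thm. 6.18] -/
theorem exists_exact_advice_of_mem_PPoly {L : Language Bool} (hL : L ∈ PPoly) :
    ∃ L' ∈ Classes.P, ∃ a : ℕ → List Bool, ∃ K : Polynomial ℕ,
      (∀ n, (a n).length = K.eval n) ∧ ∀ x, x ∈ L ↔ boolPair x (a x.length) ∈ L' := by
  obtain ⟨L₀, hL₀, a, p, hpa, ha⟩ := PPoly_subset_polyAdvice_P hL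
  refine ⟨pairFn fstP (fstP ∘ sndP) ⁻¹' L₀,
    preimage_mem_P hL₀ (pairFn_mem_FP fstP_mem_FP (comp_mem_FP fstP_mem_FP sndP_mem_FP)),
    fun n => boolPair (a n) (List.replicate (3 * p.eval n - 2 * (a n).length) false), 3 * p + 2,
    fun n => ?_, fun x => ?_⟩
  · have := hpa n
    simp only [length_boolPair, List.length_replicate, eval_add, eval_mul, eval_ofNat]
    omega
  · rw [ha x]
    change _ ↔ pairFn fstP (fstP ∘ sndP) (boolPair x (boolPair (a x.length) _)) ∈ L₀
    rw [pairFn_apply, fstP_boolPair, Function.comp_apply, sndP_boolPair, fstP_boolPair]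

namespace TallyAdvice

section Defs

variable (a : ℕ → List Bool) (K : Polynomial ℕ)

/-- **The tally language of an advice sequence**: `0^{n·K(n) + j} ∈ tallyOf a K` iff `j < K(n)`
and bit `j` of `a(n)` is `1` (the blocks `[n·K(n), n·K(n) + K(n))` are disjoint because `K` is
monotone). [cite: BalcazarBook1986, §3 (clause (i)) and Thm. 2] -/
def tallyOf : Language Bool :=
  {w | (∀ b ∈ w, b = false) ∧
    ∃ n j : ℕ, j < K.eval n ∧ w.length = n * K.eval n + j ∧ (a n).getD j false = true}

/-- **The query generator** `⟨x, bits⟩ ↦ 0^{|x|·K(|x|) + |bits|}`: round `j` asks for bit `j` of the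
advice of length `|x|`. [cite: BalcazarBook1986, §3] -/
noncomputable def genFn : List Bool → List Bool :=
  Kannan.zerosFn ∘ concatFn ∘ pairFn (padFn (X * K)) sndP

end Defs

variable (a : ℕ → List Bool) (K : Polynomial ℕ)

/-- `tallyOf a K ⊆ 0*`. [folklore] -/
theorem isTally_tallyOf : IsTally (tallyOf a K) := fun _ hw => hw.1

/-- **The blocks are disjoint**: `n·K(n) + j = n'·K(n') + j'` with `j < K(n)`, `j' < K(n')` forces
`n = n'` and `j = j'` (for `n < n'`: `n K(n) + j < (n+1) K(n) ≤ n' K(n')`). [folklore] -/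
theorem block_inj {n j n' j' : ℕ} (hj : j < K.eval n) (hj' : j' < K.eval n')
    (h : n * K.eval n + j = n' * K.eval n' + j') : n = n' ∧ j = j' := by
  have hmono : ∀ {u v : ℕ}, u < v → u * K.eval u + K.eval u ≤ v * K.eval v := fun {u v} huv => by
    have := Nat.mul_le_mul (Nat.succ_le_of_lt huv) (TM2Iter.eval_mono K huv.le)
    rwa [Nat.succ_mul] at this
  rcases lt_trichotomy n n' with hlt | rfl | hgt
  · have := hmono hlt; omega
  · exact ⟨rfl, by omega⟩
  · have := hmono hgt; omega

/-- Membership of a block string in the tally language is the advice bit. [folklore] -/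
theorem replicate_mem_tallyOf_iff {n j : ℕ} (hj : j < K.eval n) :
    List.replicate (n * K.eval n + j) false ∈ tallyOf a K ↔ (a n).getD j false = true := by
  constructor
  · rintro ⟨-, n', j', hj', hlen, hbit⟩
    rw [List.length_replicate] at hlen
    obtain ⟨rfl, rfl⟩ := block_inj K hj hj' hlen
    exact hbit
  · intro hbit
    exact ⟨fun b hb => List.eq_of_mem_replicate hb, n, j, hj, by rw [List.length_replicate], hbit⟩

/-- Value of the generator on a pair. [folklore] -/
theorem genFn_boolPair (x bits : List Bool) :
    genFn K (boolPair x bits) = List.replicate (x.length * K.eval x.length + bits.length) false := by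
  simp [genFn, padFn_apply, concatFn_boolPair]

/-- `genFn K ∈ FP`. [folklore] -/
theorem genFn_mem_FP : genFn K ∈ FP :=
  comp_mem_FP Kannan.zerosFn_mem_FP (comp_mem_FP concatFn_mem_FP (pairFn_mem_FP (padFn_mem_FP _) sndP_mem_FP))

/-- **Reading the advice off the tally oracle**: after `j ≤ K(|x|)` rounds the answer bits are the
first `j` bits of `a(|x|)` (when `|a(|x|)| = K(|x|)`). [cite: BalcazarBook1986, §3] -/
theorem adBits_genFn (x : List Bool) (hlen : (a x.length).length = K.eval x.length) :
    ∀ j ≤ K.eval x.length, adBits (genFn K) (tallyOf a K) x j = (a x.length).take j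
  | 0, _ => by rw [adBits_zero, List.take_zero]
  | j + 1, hj => by
    have hjK : j < K.eval x.length := hj
    have hj' : j < (a x.length).length := hlen ▸ hjK
    rw [adBits_succ, adBits_genFn x hlen j hjK.le, genFn_boolPair, List.length_take,
      Nat.min_eq_left hj'.le, List.take_add_one, List.getElem?_eq_getElem hj', Option.toList_some]
    congr 1
    have hmem : (tallyOf a K).boolIndicator (List.replicate (x.length * K.eval x.length + j) false) = true ↔
        (a x.length).getD j false = true :=
      (Set.mem_iff_boolIndicator _ _).symm.trans (replicate_mem_tallyOf_iff a K hjK)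
    rw [List.getD_eq_getElem?_getD, List.getElem?_eq_getElem hj', Option.getD_some] at hmem
    rw [List.cons.injEq, and_iff_left rfl, Bool.eq_iff_iff]
    exact hmem

/-- **The advice language over the tally oracle is the original language**:
`adLang genFn K L' (tallyOf a K) = L`. [cite: BalcazarBook1986, §3] -/
theorem adLang_genFn_eq {L L' : Language Bool} (hlen : ∀ n, (a n).length = K.eval n)
    (hL : ∀ x, x ∈ L ↔ boolPair x (a x.length) ∈ L') :
    adLang (genFn K) K L' (tallyOf a K) = L := by
  ext x
  rw [mem_adLang_iff, adBits_genFn a K x (hlen _) _ le_rfl, ← hlen, List.take_length, hL]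

end TallyAdvice

/-- **`P/poly ⊆ ⋃_{T tally} P^T`**: every language of polynomial circuit complexity is decidable in
polynomial time relative to a TALLY oracle (the unary encoding of its advice).
[cite: BalcazarBook1986, §3 (clause (i)) and Thm. 2] [cite: Schoning1995, §4 Theorem, (a) → (c) (pp. 528–529)] -/
theorem exists_tally_mem_PRel_of_mem_PPoly {L : Language Bool} (hL : L ∈ PPoly) :
    ∃ T : Language Bool, IsTally T ∧ L ∈ PRel (Oracle.ofLanguage T) := by
  obtain ⟨L', hL', a, K, hlen, hLa⟩ := exists_exact_advice_of_mem_PPoly hL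
  refine ⟨TallyAdvice.tallyOf a K, TallyAdvice.isTally_tallyOf a K, ?_⟩
  rw [← TallyAdvice.adLang_genFn_eq a K hlen hLa]
  exact adLang_mem_PRel (TallyAdvice.genFn_mem_FP K) hL' _


/-! ### Tally oracles with `NP ⊆ P^T` collapse: Long–Selman's argument with a `P^T` evaluator -/

namespace LongSelman

open Brick

/-- **Tally sets are low in the form needed (`EL₁`)**: if `T` is tally and `NP ⊆ P^T` then
`NP^T ⊆ P^T`. Long–Selman's table-reading proof (`NPRel_subset_PRel_of_isTally`: read the table of
`T` up to the query bound, then decide the residual `NP` predicate `L₁`), where the residual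
predicate is now decided by its `P^T` machine (`AdQuery.adLang_mem_PRel_of_mem_PRel`) instead of by
`P = NP`. (Balcázar–Book: sets `≡ᵀₚ` a tally set are in `EL₁`, `NP(T) ⊆ P(SAT ⊕ T)`, and
`P(SAT ⊕ T) = P(T)` once `SAT ∈ P(T)`; Hartmanis–Hemachandra, proof of Thm. 3.3, with
"by assumption U is in P" replaced by `U ∈ P^T`.)
[cite: BalcazarBook1986, §4 Thm. 3 and §5] [cite: HartmanisHemachandra1986, Thm. 3.3 (proof)] [cite: LongSelman1986, abstract and main theorem] -/
theorem NPRel_subset_PRel_of_isTally_of_NP_subset {T : Language Bool} (hT : IsTally T)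
    (hNP : Nondeterministic.NP ⊆ PRel (Oracle.ofLanguage T)) :
    NPRel (Oracle.ofLanguage T) ⊆ PRel (Oracle.ofLanguage T) := by
  rintro L ⟨L', hL', p, hp⟩
  obtain ⟨M, hM, q, hMq⟩ := hL'
  -- the table-fed verifier with the explicit witness-length test, and its `NP` projection
  set L₂ : Language Bool := simL M q ⊓ (forgetTableFn ⁻¹' LenLe p) with hL₂def
  have hL₂ : L₂ ∈ Classes.P :=
    inter_mem_P (simL_mem_P hM q) (preimage_mem_P (LenLe_mem_P p) forgetTableFn_mem_FP)
  set L₁ : Language Bool := {z | ∃ y : List Bool, y.length ≤ p.eval z.length ∧ boolPair z y ∈ L₂}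
    with hL₁def
  have hL₁NP : L₁ ∈ Nondeterministic.NP := ⟨L₂, hL₂, p, fun z => Iff.rfl⟩
  -- the one change w.r.t. Long–Selman: `L₁` is decided relative to `T`, by hypothesis
  have hL₁ : L₁ ∈ PRel (Oracle.ofLanguage T) := hNP hL₁NP
  -- membership in `L₂` of a coded triple
  have hmemL₂ : ∀ x t y : List Bool, boolPair (boolPair x t) y ∈ L₂ ↔
      boolPair (boolPair x t) y ∈ simL M q ∧ y.length ≤ p.eval x.length := by
    intro x t y
    change (boolPair (boolPair x t) y ∈ simL M q ∧ forgetTableFn (boolPair (boolPair x t) y) ∈ LenLe p) ↔ _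
    rw [forgetTableFn_apply, boolPair_mem_LenLe]
  -- the table length `m(|x|) = q(2|x| + 2 + p|x|) + 1` exceeds every query of `M` on `⟨x, y⟩`
  set mP : Polynomial ℕ := q.comp (2 * X + 2 + p) + 1 with hmPdef
  have hmP : ∀ x y : List Bool, y.length ≤ p.eval x.length →
      q.eval (boolPair x y).length < mP.eval x.length := by
    intro x y hy
    have h1 : q.eval (boolPair x y).length ≤ q.eval (2 * x.length + 2 + p.eval x.length) :=
      TM2Iter.eval_mono q (by simp only [length_boolPair]; omega)
    have h2 : mP.eval x.length = q.eval (2 * x.length + 2 + p.eval x.length) + 1 := by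
      simp only [hmPdef, eval_add, eval_comp, eval_mul, eval_ofNat, eval_X, eval_one]
    omega
  -- on `⟨x, y⟩` with `|y| ≤ p|x|`, the table-fed verifier accepts iff `⟨x, y⟩ ∈ L'`
  have hsim : ∀ x y : List Bool, y.length ≤ p.eval x.length →
      (boolPair (boolPair x (table T (mP.eval x.length))) y ∈ simL M q ↔ boolPair x y ∈ L') := by
    intro x y hy
    obtain ⟨hrunT, hqT⟩ := hMq (boolPair x y)
    have hagree : ∀ u ∈ M.queries (Oracle.ofLanguage T) (q.eval (boolPair x y).length) (boolPair x y),
        Oracle.ofLanguage (tabLang (table T (mP.eval x.length))) u = Oracle.ofLanguage T u :=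
      fun u hu => ofLanguage_tabLang_table hT ((hqT u hu).trans_lt (hmP x y hy))
    have hrun := (Literature.Computability.QuantumComplexity.run_congr M hagree).trans hrunT
    have hqs : ∀ u ∈ M.queries (Oracle.ofLanguage (tabLang (table T (mP.eval x.length))))
        (q.eval (boolPair x y).length) (boolPair x y), u.length ≤ q.eval (boolPair x y).length := by
      rw [Literature.Computability.QuantumComplexity.queries_congr M hagree]
      exact hqT
    rw [mem_simL_iff hrun hqs]
    exact (Set.mem_iff_boolIndicator _ _).symm
  -- `L` is the bounded adaptive reduction: read the table, then decide `⟨x, table⟩ ∈ L₁`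
  have key : L = AdQuery.adLang (Kannan.zerosFn ∘ sndP) mP L₁ T := by
    ext x
    rw [AdQuery.mem_adLang_iff, adBits_eq_table, hp x]
    change _ ↔ ∃ y : List Bool, y.length ≤ p.eval (boolPair x (table T (mP.eval x.length))).length ∧
      boolPair (boolPair x (table T (mP.eval x.length))) y ∈ L₂
    constructor
    · rintro ⟨y, hy, hxy⟩
      refine ⟨y, hy.trans (TM2Iter.eval_mono p (by simp only [length_boolPair]; omega)), ?_⟩
      exact (hmemL₂ _ _ _).2 ⟨(hsim x y hy).2 hxy, hy⟩
    · rintro ⟨y, -, hy⟩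
      obtain ⟨hsy, hy⟩ := (hmemL₂ _ _ _).1 hy
      exact ⟨y, hy, (hsim x y hy).1 hsy⟩
  rw [key]
  exact AdQuery.adLang_mem_PRel_of_mem_PRel (comp_mem_FP Kannan.zerosFn_mem_FP sndP_mem_FP) hL₁

/-- Hence a tally `T` with `NP ⊆ P^T` has `P^T = NP^T` (`P^T ⊆ NP^T` always,
`PRel_subset_NPRel_holds`). [cite: BalcazarBook1986, §4 Thm. 3] [cite: HartmanisHemachandra1986, Thm. 3.3 (proof)] -/
theorem PRel_eq_NPRel_of_isTally_of_NP_subset {T : Language Bool} (hT : IsTally T)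
    (hNP : Nondeterministic.NP ⊆ PRel (Oracle.ofLanguage T)) :
    PRel (Oracle.ofLanguage T) = NPRel (Oracle.ofLanguage T) :=
  Set.Subset.antisymm (PRel_subset_NPRel_holds _) (NPRel_subset_PRel_of_isTally_of_NP_subset hT hNP)

end LongSelman

/-! ### Assembly: the discharge and the hypothesis-free exact reach -/

/-- **`NP ⊆ P/poly` puts all of `NP` inside `P^T` for one TALLY `T`**: `SAT ∈ NP ⊆ P/poly` gives a
tally `T` with `SAT ∈ P^T` (`exists_tally_mem_PRel_of_mem_PPoly`), and every `NP` language
Karp-reduces to `SAT` (Cook–Levin, `isNPComplete_SAT_holds`), hence Cook-reduces to it, hence lies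
in `P^T` (`P^{P^T} = P^T`). [cite: AroraBarakCC2009, Thm. 2.10 and Thm. 6.18] [cite: BalcazarBook1986, §3] -/
theorem exists_tally_NP_subset_PRel_of_NP_subset_PPoly (hNP : NP ⊆ PPoly) :
    ∃ T : Language Bool, IsTally T ∧ NP ⊆ PRel (Oracle.ofLanguage T) := by
  obtain ⟨hSAT, hhard⟩ := isNPComplete_SAT_holds
  obtain ⟨T, hT, hSATT⟩ := exists_tally_mem_PRel_of_mem_PPoly (hNP hSAT)
  exact ⟨T, hT, fun L hL =>
    mem_PRel_of_polyTimeTuringReducible_holds (PolyTimeKarpReducible.turing_holds (hhard L hL)) hSATT⟩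

/-- **Discharge of `RelativizationSparseNarrow`**: if `NP ⊆ P/poly` then `P^T = NP^T` for some
tally `T ⊆ 0*`. [cite: BalcazarBook1986, §4 Thm. 3] [cite: HartmanisHemachandra1986, Thm. 3.3 (proof)] -/
theorem RelativizationSparseNarrow_holds : RelativizationSparseNarrow := fun hNP => by
  obtain ⟨T, hT, hNPT⟩ := exists_tally_NP_subset_PRel_of_NP_subset_PPoly hNP
  exact ⟨T, hT, LongSelman.PRel_eq_NPRel_of_isTally_of_NP_subset hT hNPT⟩

/-- **Exact reach over tally oracles, hypothesis-free**: `P ≠ NP` in the summit's shape is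
TALLY-relativizing iff `NP ⊄ P/poly`. [cite: BalcazarBook1986, §4 Thm. 3] [cite: Schoning1986, §6.1 (remark after Cor. 6.4)] -/
theorem tally_cRelativizes_pneNP_shape_iff :
    (CRelativizes {T | IsTally T} fun O => ∃ L ∈ NPRel O, L ∉ PRel O) ↔ ¬ NP ⊆ PPoly :=
  RelativizationSparseNarrow_holds.cRelativizes_tally_iff

/-- **Exact reach over sparse oracles, hypothesis-free**: SPARSE-relativizing iff `NP ⊄ P/poly`.
[cite: BalcazarBook1986, §4 Thm. 3] [cite: Schoning1995, §3 (p. 527) and §4 (pp. 528–529)] -/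
theorem sparse_cRelativizes_pneNP_shape_iff :
    (CRelativizes {S | IsSparseLanguage S} fun O => ∃ L ∈ NPRel O, L ∉ PRel O) ↔ ¬ NP ⊆ PPoly :=
  RelativizationSparseNarrow_holds.cRelativizes_sparse_iff

/-- **Exact reach over `P/poly` oracles, hypothesis-free.** [cite: AroraBarakCC2009, Thm. 6.18 with Def. 6.5] [cite: BalcazarBook1986, §4 Thm. 3] -/
theorem ppoly_cRelativizes_pneNP_shape_iff :
    (CRelativizes PPoly fun O => ∃ L ∈ NPRel O, L ∉ PRel O) ↔ ¬ NP ⊆ PPoly :=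
  RelativizationSparseNarrow_holds.cRelativizes_PPoly_iff

/-- **A thin collapsing oracle exists iff `NP ⊆ P/poly`** (tally, sparse, `P/poly`: three `iff`s),
hypothesis-free. [cite: BalcazarBook1986, §4 Thm. 3] [cite: AroraBarakCC2009, Thm. 6.18 with Def. 6.5] -/
theorem exists_thin_collapse_iff :
    ((∃ T : Language Bool, IsTally T ∧ PRel (Oracle.ofLanguage T) = NPRel (Oracle.ofLanguage T)) ↔
        NP ⊆ PPoly) ∧
      ((∃ S : Language Bool, IsSparseLanguage S ∧ PRel (Oracle.ofLanguage S) = NPRel (Oracle.ofLanguage S)) ↔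
        NP ⊆ PPoly) ∧
      ((∃ A ∈ PPoly, PRel (Oracle.ofLanguage A) = NPRel (Oracle.ofLanguage A)) ↔ NP ⊆ PPoly) :=
  RelativizationSparseNarrow_holds.exists_tally_collapse_iff

/-- **The loophole is the non-uniform programme, hypothesis-free**: a tally-robust proof of
`P ≠ NP` (summit shape relative to every tally oracle) is a proof of `NP ⊄ P/poly`.
[cite: BalcazarBook1986, §4 Thm. 3] [cite: HartmanisHemachandra1986, Thm. 3.3] -/
theorem not_NP_subset_PPoly_of_tally_cRelativizes_pneNP_shape
    (hc : CRelativizes {T | IsTally T} fun O => ∃ L ∈ NPRel O, L ∉ PRel O) : ¬ NP ⊆ PPoly :=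
  tally_cRelativizes_pneNP_shape_iff.1 hc

/-- **Schöning's negative relativization, exact status, hypothesis-free**:
`(P ≠ NP ↔ ∀ sparse S, P(S) ≠ NP(S)) ↔ (P ≠ NP → NP ⊄ P/poly)`. [cite: Schoning1986, §6.2] [cite: KarpLipton1980, Thm. 6.1] -/
theorem negativeRelativization_sparse_iff :
    (P ≠ NP ↔ CRelativizes {S | IsSparseLanguage S} fun O => PRel O ≠ NPRel O) ↔
      (P ≠ NP → ¬ NP ⊆ PPoly) :=
  RelativizationSparseNarrow_holds.negativeRelativization_sparse_iff

/-- **Tally-oracle independence of `P` vs `NP`, exact status, hypothesis-free**: decided the same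
way in every tally world iff `P = NP ∨ NP ⊄ P/poly`. [cite: LongSelman1986, abstract and main theorem] [cite: BalcazarBook1986, §4 Thm. 3] -/
theorem tally_independent_iff :
    ((CRelativizes {T | IsTally T} fun O => PRel O = NPRel O) ∨
        CRelativizes {T | IsTally T} fun O => ∃ L ∈ NPRel O, L ∉ PRel O) ↔
      (P = NP ∨ ¬ NP ⊆ PPoly) :=
  RelativizationSparseNarrow_holds.tally_independent_iff

/-- **Summary, every hypothesis discharged.** [cite: BalcazarBook1986, §4 Thm. 3] [cite: HartmanisHemachandra1986, Thm. 3.3] [cite: AroraBarakCC2009, Thm. 6.18 with Def. 6.5] [cite: KarpLipton1980, Thm. 6.1] -/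
theorem relativizationSparseNarrow_summary_holds :
    ((CRelativizes {T | IsTally T} fun O => ∃ L ∈ NPRel O, L ∉ PRel O) ↔ ¬ NP ⊆ PPoly) ∧
      ((CRelativizes {S | IsSparseLanguage S} fun O => ∃ L ∈ NPRel O, L ∉ PRel O) ↔ ¬ NP ⊆ PPoly) ∧
      ((CRelativizes PPoly fun O => ∃ L ∈ NPRel O, L ∉ PRel O) ↔ ¬ NP ⊆ PPoly) ∧
      ((CRelativizes {T | IsTally T} fun O => ∃ L ∈ NPRel O, L ∉ PRel O) → ¬ NP ⊆ PPoly) ∧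
      (¬ NP ⊆ PPoly → CRelativizes PPoly fun O => ∃ L ∈ NPRel O, L ∉ PRel O) ∧
      ((¬ CRelativizes PPoly fun O => ∃ L ∈ NPRel O, L ∉ PRel O) → PH = SigmaP 2) :=
  RelativizationSparseNarrow_holds.summary

end Literature.Barriers.PneNP
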